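import Literature.Geometry.Lorentzian.ModelDataProofs
import Literature.Geometry.Lorentzian.GeodesicConfinement
import HarnessLib

/-!
# The two-ended time-symmetric Schwarzschild data are complete (discharge of `Schwarzschild.isComplete_timeSymmetricData`)

Discharge of the named fact `Schwarzschild.isComplete_timeSymmetricData` (`ModelData.lean`): for
`M > 0` the time-symmetric Schwarzschild data `(E3 ∖ {0}, ψ⁴ δ, 0)`, `ψ = 1 + M/(2‖y‖)`, are
complete, i.e. the Levi-Civita connection of `ψ⁴ δ` on the punctured slice is geodesically
complete (`InitialDataSet.IsComplete`). Brill–Lindquist, Phys. Rev. 131 (1963); MTW 1973, §31.7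
(near the puncture `ψ⁴ δ ∼ (M/2r)⁴ δ` is a second asymptotically flat end); Bartnik 1986, §1.

## Proof (Gordon's criterion)

By W. B. Gordon's completeness criterion in the form proved in the tree
(`PseudoRiemannianMetric.isGeodesicallyComplete_of_properFunction`, `GeodesicConfinement.lean`;
Gordon, Proc. AMS 37 (1973), Theorem: a Riemannian manifold carrying a proper function with
bounded gradient is complete) it suffices to exhibit a differentiable function `ρ` on the
punctured slice with relatively compact sublevel sets and `|dρ(v)| ≤ L |v|_{ψ⁴δ}`. Take
`ρ(y) = ‖y‖ + 1/‖y‖` (it tends to `+∞` at both ends `‖y‖ → 0` and `‖y‖ → ∞`): the sublevel set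
`{ρ ≤ s}` lies in the compact shell `{1/s ≤ ‖y‖ ≤ s}` of the punctured slice, and
`dρ_y(v) = (1 − 1/‖y‖²) ⟪y, v⟫/‖y‖`, so `|dρ_y(v)| ≤ (1 + 1/r²) ‖v‖ ≤ (1 + 4/M²) ψ(y)² ‖v‖ =
(1 + 4/M²) |v|_{ψ⁴δ}` (`r = ‖y‖`, `ψ² ≥ 1 + M²/(4r²)`), with `|v|_{ψ⁴δ} = √(ψ⁴ ‖v‖²) = ψ² ‖v‖`.

* `Schwarzschild.hasFDerivAt_norm_add_inv_norm` — `d(‖·‖ + ‖·‖⁻¹)_y = ((1 − ‖y‖⁻²)/‖y‖) ⟪y, ·⟫`;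
* `Schwarzschild.gordon_bound` — the elementary inequality `1 + 1/r² ≤ (1 + 4/M²)(1 + M/(2r))²`;
* `Schwarzschild.isComplete_timeSymmetricData_holds` — **the named fact, verbatim**.

Everything is proved; no definitions, no named facts.

## References

* W. B. Gordon, *An analytical criterion for the completeness of Riemannian manifolds*, Proc.
  Amer. Math. Soc. 37 (1973) 221–225, Theorem.
* D. R. Brill, R. W. Lindquist, *Interaction energy in geometrostatics*, Phys. Rev. 131 (1963)
  471–476.
* C. W. Misner, K. S. Thorne, J. A. Wheeler, *Gravitation*, Freeman 1973, §31.7.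
* R. Bartnik, *The mass of an asymptotically flat manifold*, CPAM 39 (1986), §1.
-/

noncomputable section

open Set Metric TopologicalSpace Topology
open scoped RealInnerProductSpace ContDiff Manifold

namespace Literature.Geometry.Lorentzian

namespace Schwarzschild

/-- **The differential of Gordon's exhaustion function `ρ(y) = ‖y‖ + 1/‖y‖`** off the origin:
`dρ_y = ((1 − ‖y‖⁻²)/‖y‖) ⟪y, ·⟫` (`d‖·‖_y = ⟪y, ·⟫/‖y‖`). Gordon 1973 (the exhaustion function of
the criterion); MTW 1973, §31.7. [cite: Gordon1973, Theorem] -/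
theorem hasFDerivAt_norm_add_inv_norm {y : E3} (hy : y ≠ 0) :
    HasFDerivAt (fun z : E3 ↦ ‖z‖ + ‖z‖⁻¹)
      ((‖y‖⁻¹ * (1 - (‖y‖ ^ 2)⁻¹)) • (innerSL ℝ y : E3 →L[ℝ] ℝ)) y := by
  have hny : ‖y‖ ≠ 0 := norm_ne_zero_iff.mpr hy
  -- `d‖·‖_y = ⟪y, ·⟫/‖y‖`
  have hn : HasFDerivAt (fun z : E3 ↦ ‖z‖) (‖y‖⁻¹ • (innerSL ℝ y : E3 →L[ℝ] ℝ)) y := by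
    have h1 := (hasStrictFDerivAt_norm_sq y).hasFDerivAt
    have h2 : HasDerivAt (fun r : ℝ ↦ √r) (1 / (2 * √(‖y‖ ^ 2))) (‖y‖ ^ 2) :=
      Real.hasDerivAt_sqrt (by positivity)
    have h3 := h2.comp_hasFDerivAt y h1
    have hfun : ((fun r : ℝ ↦ √r) ∘ fun z : E3 ↦ ‖z‖ ^ 2) = fun z : E3 ↦ ‖z‖ :=
      funext fun z ↦ Real.sqrt_sq (norm_nonneg z)
    rw [hfun, Real.sqrt_sq (norm_nonneg y),
      ← Nat.cast_smul_eq_nsmul ℝ 2 (innerSL ℝ y : E3 →L[ℝ] ℝ), smul_smul] at h3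
    refine h3.congr_fderiv ?_
    congr 1
    push_cast
    field_simp
  have hinv := (hasDerivAt_inv hny).comp_hasFDerivAt y hn
  have h := hn.add hinv
  refine h.congr_fderiv ?_
  rw [smul_smul, ← add_smul]
  congr 1
  field_simp
  ring

/-- **The gradient bound of Gordon's criterion for `ψ⁴ δ`**: `1 + 1/r² ≤ (1 + 4/M²)(1 + M/(2r))²`
for `M ≠ 0`, `r > 0` (the difference is `M/r + M²/(4r²) + 4/M² + 4/(Mr)`, for `M > 0`), i.e.
`|dρ| ≤ (1 + 1/r²)|v|_δ ≤ (1 + 4/M²) ψ² |v|_δ = (1 + 4/M²) |v|_{ψ⁴δ}`. MTW 1973, §31.7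
(`ψ = 1 + M/(2r)`). [cite: MTW1973, §31.7] -/
theorem gordon_bound {M r : ℝ} (hM : 0 < M) (hr : 0 < r) :
    1 + (r ^ 2)⁻¹ ≤ (1 + 4 / M ^ 2) * (1 + M / (2 * r)) ^ 2 := by
  have hM0 : M ≠ 0 := hM.ne'
  have hr0 : r ≠ 0 := hr.ne'
  have h : (1 + 4 / M ^ 2) * (1 + M / (2 * r)) ^ 2 - (1 + (r ^ 2)⁻¹) =
      M / r + M ^ 2 / (4 * r ^ 2) + 4 / M ^ 2 + 4 / (M * r) := by
    field_simp
    ring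
  have hpos : 0 ≤ M / r + M ^ 2 / (4 * r ^ 2) + 4 / M ^ 2 + 4 / (M * r) := by positivity
  linarith

/-- **Discharge of the named fact `Schwarzschild.isComplete_timeSymmetricData`** (`ModelData.lean`),
verbatim: for `M > 0` (and under the standing Levi-Civita hypothesis of `InitialDataSet.IsComplete`)
the two-ended time-symmetric Schwarzschild data `(E3 ∖ {0}, ψ⁴ δ, 0)` are geodesically complete.
Gordon's criterion (`PseudoRiemannianMetric.isGeodesicallyComplete_of_properFunction`) with the
exhaustion function `ρ(y) = ‖y‖ + 1/‖y‖` of the punctured slice: `{ρ ≤ s} ⊆ {1/s ≤ ‖y‖ ≤ s}` is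
compact and `|dρ(v)| ≤ (1 + 4/M²) |v|_{ψ⁴δ}` (`hasFDerivAt_norm_add_inv_norm`, `gordon_bound`).
Brill–Lindquist 1963; MTW 1973, §31.7; Bartnik 1986, §1; Gordon 1973, Theorem.
[cite: MTW1973, §31.7] -/
theorem isComplete_timeSymmetricData_holds : ∀ M : ℝ, isComplete_timeSymmetricData M := by
  intro M hM _
  unfold InitialDataSet.IsComplete
  have hM0 : M ≠ 0 := hM.ne'
  haveI : LocallyCompactSpace puncturedSlice :=
    puncturedSlice.2.isOpenEmbedding_subtypeVal.locallyCompactSpace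
  have hne : ∀ q : puncturedSlice, (q : E3) ≠ 0 := fun q h ↦
    zero_notMem_puncturedSlice (h ▸ q.2)
  have hnq : ∀ q : puncturedSlice, 0 < ‖(q : E3)‖ := fun q ↦ norm_pos_iff.2 (hne q)
  -- Gordon's exhaustion function `ρ(y) = ‖y‖ + 1/‖y‖`
  set ρE : E3 → ℝ := fun z ↦ ‖z‖ + ‖z‖⁻¹ with hρE
  set ρ : puncturedSlice → ℝ := fun q ↦ ρE q with hρ
  have hρd : ∀ q : puncturedSlice, DifferentiableAt ℝ ρE (q : E3) := fun q ↦
    (hasFDerivAt_norm_add_inv_norm (hne q)).differentiableAt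
  refine PseudoRiemannianMetric.isGeodesicallyComplete_of_properFunction (I := 𝓘(ℝ, E3))
    (g := (timeSymmetricData M hM.le).metric) (ρ := ρ) (L := 1 + 4 / M ^ 2)
    (WithTop.coe_le_coe.mpr le_top) (fun x v hv ↦ (timeSymmetricData M hM.le).h.pos x v hv)
    (by positivity) (fun q ↦ (OpensChart.mdifferentiableAt_iff q ρ ρE (fun _ ↦ rfl)).2 (hρd q))
    (fun q (v : E3) ↦ ?_) (fun s ↦ ?_)
  · -- the gradient bound `|dρ(v)| ≤ (1 + 4/M²) ψ² ‖v‖ = (1 + 4/M²) |v|_{ψ⁴δ}`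
    have hr := hnq q
    have hr0 : ‖(q : E3)‖ ≠ 0 := hr.ne'
    rw [OpensChart.mvfderiv_eq q ρ ρE (fun _ ↦ rfl) (hρd q) v,
      (hasFDerivAt_norm_add_inv_norm (hne q)).fderiv]
    have hval : (timeSymmetricData M hM.le).metric.val q v v =
        conformalFactor M q ^ 4 * ‖v‖ ^ 2 := by
      rw [← real_inner_self_eq_norm_sq]
      rfl
    have hψ : 0 < conformalFactor M q := conformalFactor_pos hM.le _
    have hsqrt : Real.sqrt ((timeSymmetricData M hM.le).metric.val q v v) =
        conformalFactor M q ^ 2 * ‖v‖ := by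
      rw [hval, show conformalFactor M q ^ 4 * ‖v‖ ^ 2 =
        (conformalFactor M q ^ 2 * ‖v‖) ^ 2 by ring]
      exact Real.sqrt_sq (by positivity)
    rw [hsqrt]
    change |(‖(q : E3)‖⁻¹ * (1 - (‖(q : E3)‖ ^ 2)⁻¹)) * ⟪(q : E3), v⟫| ≤ _
    have h1 : |(‖(q : E3)‖⁻¹ * (1 - (‖(q : E3)‖ ^ 2)⁻¹)) * ⟪(q : E3), v⟫| ≤
        (1 + (‖(q : E3)‖ ^ 2)⁻¹) * ‖v‖ := by
      rw [abs_mul, abs_mul, abs_of_pos (inv_pos.2 hr)]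
      have hi : |⟪(q : E3), v⟫| ≤ ‖(q : E3)‖ * ‖v‖ := abs_real_inner_le_norm _ _
      have ht : |1 - (‖(q : E3)‖ ^ 2)⁻¹| ≤ 1 + (‖(q : E3)‖ ^ 2)⁻¹ := by
        refine (abs_sub _ _).trans ?_
        rw [abs_one, abs_of_pos (by positivity)]
      calc ‖(q : E3)‖⁻¹ * |1 - (‖(q : E3)‖ ^ 2)⁻¹| * |⟪(q : E3), v⟫|
          ≤ ‖(q : E3)‖⁻¹ * (1 + (‖(q : E3)‖ ^ 2)⁻¹) * (‖(q : E3)‖ * ‖v‖) := by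
            gcongr
        _ = (1 + (‖(q : E3)‖ ^ 2)⁻¹) * ‖v‖ := by
            field_simp
    have h2 : (1 + (‖(q : E3)‖ ^ 2)⁻¹) * ‖v‖ ≤
        (1 + 4 / M ^ 2) * (conformalFactor M q ^ 2 * ‖v‖) := by
      rw [← mul_assoc]
      refine mul_le_mul_of_nonneg_right ?_ (norm_nonneg _)
      rw [conformalFactor_apply]
      exact gordon_bound hM hr
    exact h1.trans h2
  · -- properness: `{ρ ≤ s} ⊆ {1/s ≤ ‖y‖ ≤ s}`, a compact shell of the punctured slice
    set K : Set E3 := {y : E3 | s⁻¹ ≤ ‖y‖} ∩ closedBall (0 : E3) s with hK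
    have hKc : IsCompact K :=
      Metric.isCompact_of_isClosed_isBounded
        ((isClosed_le continuous_const continuous_norm).inter isClosed_closedBall)
        (isBounded_closedBall.subset inter_subset_right)
    refine ⟨Subtype.val ⁻¹' K, ?_, fun q hq ↦ ?_⟩
    · rcases le_or_gt s 0 with hs | hs
      · -- `s ≤ 0`: the preimage is empty (`‖y‖ ≤ s ≤ 0` is impossible on the punctured slice)
        have hempty : (Subtype.val ⁻¹' K : Set puncturedSlice) = ∅ := by
          ext q
          simp only [mem_preimage, hK, mem_inter_iff, mem_setOf_eq, mem_closedBall, dist_zero_right,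
            mem_empty_iff_false, iff_false, not_and]
          intro _ hqs
          exact absurd (hqs.trans hs) (not_le.2 (hnq q))
        rw [hempty]
        exact isCompact_empty
      · -- `K ⊆ puncturedSlice` since `s⁻¹ ≤ ‖y‖` forces `0 < ‖y‖`
        refine Topology.IsInducing.subtypeVal.isCompact_preimage' hKc fun y hy ↦ ?_
        have hy' : y ∈ puncturedSlice := by
          rw [mem_puncturedSlice]
          exact lt_of_lt_of_le (inv_pos.2 hs) hy.1
        exact ⟨⟨y, hy'⟩, rfl⟩
    · have hr := hnq q
      have hq' : ‖(q : E3)‖ + ‖(q : E3)‖⁻¹ ≤ s := hq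
      have hle1 : ‖(q : E3)‖ ≤ s := by
        have : 0 ≤ ‖(q : E3)‖⁻¹ := by positivity
        linarith
      have hle2 : s⁻¹ ≤ ‖(q : E3)‖ := by
        have hs : 0 < s := lt_of_lt_of_le hr hle1
        have : ‖(q : E3)‖⁻¹ ≤ s := by
          have : 0 ≤ ‖(q : E3)‖ := norm_nonneg _
          linarith
        rw [inv_le_comm₀ hs hr]
        exact this
      exact ⟨hle2, mem_closedBall_zero_iff.2 hle1⟩

end Schwarzschild

end Literature.Geometry.Lorentzian

end
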